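import Mathlib
import HarnessLib
import Summits.HubbardSuperconductivity.HubbardSuperconductivity.Theorems.KLProgrammeH10TwoPointLimitIsoSymbolDiffs

/-!
# Route `KLProgramme` — engine support, route (L2): bookkeeping for the ISOTROPIC single-family torus bound `T̂_iso`
# (hypothesis `hT` of `EngineV8.isoTupleL1AtS_zero_of_klEng`, ENGINE item stmt-HubbardSuperconductivity-19918) — rates, support
# factor, assembly of the two square roots, and the vanishing of the isotropic multipliers below the temperature scale

Cell `gate-hubbard-kl`, seat p4 (C5a lead), g7; plan g13 GO «p4: type T̂_iso» (J3a).  Pure-real lemmas feeding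
`iso_torusSum_le_frame` / `iso_torusSum_of_frameOK` (file `…IsoTorusSum`), at the isotropic rates `s₀ = 2Λβ/(4M·π√c_G)`,
`s₁ = 2Λ/(π√κ)`:

* `iso_bracket_le` — near + far bracket `4(2√2/s₁+2)² + 16(1/s₁+1)² ≤ κ_X/Λ²`;
* `iso_supp_le` — the support factor `(Λβ/π+1)·#cell ≤ (5Λβ/π)(LΛ)²c_N` for the iso cell of radius `r̄Λ`;
* `iso_assemble` — `(1/(|β|L²))√X₁√X₂ ≤ √C·M/β` from `X₁ ≲ M/(Λ³β)`, `X₂ ≲ MβL⁴Λ³`;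
* `klIsoFamily_eq_zero_of_klScale_lt` — if `Λ_m < π/β` then `klIsoFamily … m ≡ 0` (`|k₀| ≥ π/β`).

Everything is proved; no definitions, no named facts. [cite: BenfattoGiulianiMastropietro2006, §2.5 (2.57), §2.6 (2.81)]
-/

noncomputable section

namespace Summit.HubbardSuperconductivity.HubbardSuperconductivity.Theorems.TorusFourierL2

set_option linter.dupNamespace false -- summit = problem name (single-conjunct summit), D-0017

open Set Finset Literature.MathematicalPhysics.QuantumLattice Literature.MathematicalPhysics.QuantumLattice.BandSectorCounting
open Literature.MathematicalPhysics.QuantumLattice.FermiRG Literature.Probability.LatticeModels Literature.Analysis.SpecialFunctions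
open Summit.HubbardSuperconductivity.HubbardSuperconductivity.Theorems.DispersionFlow
open Summit.HubbardSuperconductivity.HubbardSuperconductivity.Theorems.KLRegimeSplit
open Summit.HubbardSuperconductivity.HubbardSuperconductivity.Theorems.KLProgrammeLegKernels
open Summit.HubbardSuperconductivity.HubbardSuperconductivity.Theorems.PerturbedFermiCurve
open scoped Real ComplexConjugate

/-! ### §1 Pure-real bookkeeping of the isotropic rates -/

/-- **The near + far bracket at one space rate** `s₁ = 2Λ/(π√κ)`: `4(2√2/s₁+2)² + 16(1/s₁+1)² ≤ κ_X/Λ²`,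
`κ_X = 4(√2π√κ + 2e₀)² + 16(π√κ/2 + e₀)²` (`Λ ≤ e₀`). [folklore] -/
theorem iso_bracket_le {κ Λ e₀ : ℝ} (hκ : 0 < κ) (hΛ : 0 < Λ) (hΛe : Λ ≤ e₀) :
    4 * ((2 * Real.sqrt 2 / (2 * Λ / (π * Real.sqrt κ)) + 2) * (2 * Real.sqrt 2 / (2 * Λ / (π * Real.sqrt κ)) + 2)) +
        16 * (1 / (2 * Λ / (π * Real.sqrt κ)) + 1) ^ 2 ≤
      (4 * (Real.sqrt 2 * π * Real.sqrt κ + 2 * e₀) ^ 2 + 16 * (π * Real.sqrt κ / 2 + e₀) ^ 2) / Λ ^ 2 := by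
  have hs : 0 < Real.sqrt κ := Real.sqrt_pos.2 hκ
  have h2 : 0 < Real.sqrt 2 := Real.sqrt_pos.2 (by norm_num)
  have hπ := Real.pi_pos
  have e1 : 2 * Real.sqrt 2 / (2 * Λ / (π * Real.sqrt κ)) = Real.sqrt 2 * π * Real.sqrt κ / Λ := by
    field_simp
  have e2 : 1 / (2 * Λ / (π * Real.sqrt κ)) = π * Real.sqrt κ / 2 / Λ := by
    field_simp
  rw [e1, e2]
  have hn : Real.sqrt 2 * π * Real.sqrt κ / Λ + 2 ≤ (Real.sqrt 2 * π * Real.sqrt κ + 2 * e₀) / Λ := by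
    rw [add_div, add_le_add_iff_left, le_div_iff₀ hΛ]
    linarith
  have hf : π * Real.sqrt κ / 2 / Λ + 1 ≤ (π * Real.sqrt κ / 2 + e₀) / Λ := by
    rw [add_div, add_le_add_iff_left, le_div_iff₀ hΛ]
    linarith
  have hn0 : 0 ≤ Real.sqrt 2 * π * Real.sqrt κ / Λ + 2 := by positivity
  have hf0 : 0 ≤ π * Real.sqrt κ / 2 / Λ + 1 := by positivity
  calc 4 * ((Real.sqrt 2 * π * Real.sqrt κ / Λ + 2) * (Real.sqrt 2 * π * Real.sqrt κ / Λ + 2)) +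
        16 * (π * Real.sqrt κ / 2 / Λ + 1) ^ 2 ≤
      4 * (((Real.sqrt 2 * π * Real.sqrt κ + 2 * e₀) / Λ) * ((Real.sqrt 2 * π * Real.sqrt κ + 2 * e₀) / Λ)) +
        16 * ((π * Real.sqrt κ / 2 + e₀) / Λ) ^ 2 :=
        add_le_add (mul_le_mul_of_nonneg_left (mul_le_mul hn hn hn0 (hn0.trans hn)) (by norm_num))
          (mul_le_mul_of_nonneg_left (pow_le_pow_left₀ hf0 hf 2) (by norm_num))
    _ = (4 * (Real.sqrt 2 * π * Real.sqrt κ + 2 * e₀) ^ 2 + 16 * (π * Real.sqrt κ / 2 + e₀) ^ 2) / Λ ^ 2 := by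
      rw [← sq ((Real.sqrt 2 * π * Real.sqrt κ + 2 * e₀) / Λ), div_pow, div_pow, mul_div_assoc', mul_div_assoc', ← add_div]

/-- **The isotropic support factor**: with `ρ = r̄Λ`, `1 ≤ LΛ`, `π/(4β) ≤ Λ`, `Λ ≤ e₀`:
`(Λβ/π + 1)(√2L((Λ + K₂ρ²)/γ)/π + 2)(√2L(2ρ)/π + 2) ≤ (5Λβ/π)(LΛ)²·c₁c₂`, `c₁ = √2(1 + K₂r̄²e₀)/(γπ) + 2`, `c₂ = 2√2r̄/π + 2`.
[folklore] -/
theorem iso_supp_le {Λ β L ρ r e₀ K₂ γ : ℝ} (hΛ : 0 < Λ) (hβ : 0 < β) (hL : 0 < L) (hρ : ρ = r * Λ) (hr : 0 ≤ r) (hK₂ : 0 ≤ K₂)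
    (hγ : 0 < γ) (hLΛ : 1 ≤ L * Λ) (hΛβ : π / (4 * β) ≤ Λ) (hΛe : Λ ≤ e₀) :
    (Λ * β / π + 1) * ((Real.sqrt 2 * L * ((Λ + K₂ * ρ ^ 2) / γ) / π + 2) * (Real.sqrt 2 * L * (2 * ρ) / π + 2)) ≤
      5 * Λ * β / π * (L * Λ) ^ 2 * ((Real.sqrt 2 * (1 + K₂ * r ^ 2 * e₀) / (γ * π) + 2) * (2 * Real.sqrt 2 * r / π + 2)) := by
  have hπ := Real.pi_pos
  have h2 : 0 ≤ Real.sqrt 2 := Real.sqrt_nonneg 2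
  subst hρ
  have hA : Λ * β / π + 1 ≤ 5 * Λ * β / π := by
    have h4 : π ≤ 4 * β * Λ := by
      rw [div_le_iff₀ (by positivity)] at hΛβ; linarith
    have e : 5 * Λ * β / π = Λ * β / π + 4 * β * Λ / π := by ring
    rw [e, add_le_add_iff_left, le_div_iff₀ hπ]
    linarith
  have hB : Real.sqrt 2 * L * ((Λ + K₂ * (r * Λ) ^ 2) / γ) / π + 2 ≤
      L * Λ * (Real.sqrt 2 * (1 + K₂ * r ^ 2 * e₀) / (γ * π) + 2) := by
    have h1 : Λ + K₂ * (r * Λ) ^ 2 ≤ Λ * (1 + K₂ * r ^ 2 * e₀) := by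
      have e : Λ * (1 + K₂ * r ^ 2 * e₀) = Λ + Λ * (K₂ * r ^ 2 * e₀) := by ring
      have e' : K₂ * (r * Λ) ^ 2 = Λ * (K₂ * r ^ 2 * Λ) := by ring
      rw [e, e', add_le_add_iff_left]
      exact mul_le_mul_of_nonneg_left (mul_le_mul_of_nonneg_left hΛe (by positivity)) hΛ.le
    have h1' : Real.sqrt 2 * L * ((Λ + K₂ * (r * Λ) ^ 2) / γ) / π ≤
        L * Λ * (Real.sqrt 2 * (1 + K₂ * r ^ 2 * e₀) / (γ * π)) := by
      calc Real.sqrt 2 * L * ((Λ + K₂ * (r * Λ) ^ 2) / γ) / π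
          ≤ Real.sqrt 2 * L * ((Λ * (1 + K₂ * r ^ 2 * e₀)) / γ) / π := by gcongr
        _ = L * Λ * (Real.sqrt 2 * (1 + K₂ * r ^ 2 * e₀) / (γ * π)) := by
          field_simp
    have h3 : (2 : ℝ) ≤ L * Λ * 2 := by linarith
    rw [mul_add]
    linarith
  have hC : Real.sqrt 2 * L * (2 * (r * Λ)) / π + 2 ≤ L * Λ * (2 * Real.sqrt 2 * r / π + 2) := by
    have e1 : Real.sqrt 2 * L * (2 * (r * Λ)) / π = L * Λ * (2 * Real.sqrt 2 * r / π) := by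
      field_simp
    have h3 : (2 : ℝ) ≤ L * Λ * 2 := by linarith
    rw [mul_add, e1]
    linarith
  have hB0 : 0 ≤ Real.sqrt 2 * L * ((Λ + K₂ * (r * Λ) ^ 2) / γ) / π + 2 := by positivity
  have hC0 : 0 ≤ Real.sqrt 2 * L * (2 * (r * Λ)) / π + 2 := by positivity
  calc (Λ * β / π + 1) * ((Real.sqrt 2 * L * ((Λ + K₂ * (r * Λ) ^ 2) / γ) / π + 2) *
        (Real.sqrt 2 * L * (2 * (r * Λ)) / π + 2))
      ≤ (5 * Λ * β / π) * ((L * Λ * (Real.sqrt 2 * (1 + K₂ * r ^ 2 * e₀) / (γ * π) + 2)) *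
          (L * Λ * (2 * Real.sqrt 2 * r / π + 2))) :=
        mul_le_mul hA (mul_le_mul hB hC hC0 (hB0.trans hB)) (by positivity) (by positivity)
    _ = 5 * Λ * β / π * (L * Λ) ^ 2 *
          ((Real.sqrt 2 * (1 + K₂ * r ^ 2 * e₀) / (γ * π) + 2) * (2 * Real.sqrt 2 * r / π + 2)) := by ring

/-- **Assembling the two square roots**: `X₁ ≤ a·M/(Λ³β)`, `X₂ ≤ b·MβL⁴Λ³` give `(1/(|β|L²))·√X₁·√X₂ ≤ √(ab)·M/β`, here with
`a = 2048·2(π√c_G+1)κ_X`, `b = 64·(5/π)c_N`. [folklore] -/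
theorem iso_assemble {X₁ X₂ Λ β M L cG κX cN : ℝ} (hΛ : 0 < Λ) (hβ : 0 < β) (hM : 0 < M) (hL : 0 < L)
    (hκX : 0 ≤ κX) (hcN : 0 ≤ cN) (hX₁ : 0 ≤ X₁) (hX₂ : 0 ≤ X₂)
    (h1 : X₁ ≤ 2048 * (2 * M / (Λ * β) * (π * Real.sqrt cG + 1)) * (κX / Λ ^ 2))
    (h2 : X₂ ≤ 16 * (2 * (2 * M)) * L ^ 2 * (5 * Λ * β / π * (L * Λ) ^ 2 * cN)) :
    1 / (|β| * L ^ 2) * (Real.sqrt X₁ * Real.sqrt X₂) ≤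
      Real.sqrt (2048 * (π * Real.sqrt cG + 1) * κX * (640 / π * cN)) * M / β := by
  have hπ := Real.pi_pos
  rw [abs_of_pos hβ, ← Real.sqrt_mul hX₁]
  set C : ℝ := 2048 * (π * Real.sqrt cG + 1) * κX * (640 / π * cN) with hC
  have hC0 : 0 ≤ C := by rw [hC]; positivity
  have hb0 : 0 ≤ 2048 * (2 * M / (Λ * β) * (π * Real.sqrt cG + 1)) * (κX / Λ ^ 2) := by positivity
  have hprod : X₁ * X₂ ≤ (Real.sqrt C * M * L ^ 2) ^ 2 := by
    calc X₁ * X₂ ≤ (2048 * (2 * M / (Λ * β) * (π * Real.sqrt cG + 1)) * (κX / Λ ^ 2)) *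
          (16 * (2 * (2 * M)) * L ^ 2 * (5 * Λ * β / π * (L * Λ) ^ 2 * cN)) := mul_le_mul h1 h2 hX₂ hb0
      _ = C * (M * L ^ 2) ^ 2 := by
          rw [hC, div_mul_eq_mul_div, eq_comm]
          field_simp
          ring
      _ = (Real.sqrt C * M * L ^ 2) ^ 2 := by simp only [mul_pow, Real.sq_sqrt hC0]; ring
  calc 1 / (β * L ^ 2) * Real.sqrt (X₁ * X₂) ≤ 1 / (β * L ^ 2) * (Real.sqrt C * M * L ^ 2) := by
        refine mul_le_mul_of_nonneg_left ?_ (by positivity)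
        calc Real.sqrt (X₁ * X₂) ≤ Real.sqrt ((Real.sqrt C * M * L ^ 2) ^ 2) := Real.sqrt_le_sqrt hprod
          _ = Real.sqrt C * M * L ^ 2 := Real.sqrt_sq (by positivity)
    _ = Real.sqrt C * M / β := by
        rw [div_mul_eq_mul_div, one_mul, div_eq_div_iff (by positivity) hβ.ne']
        ring

/-! ### §2 Inactive scales: the multiplier vanishes -/

/-- **Below the temperature scale the isotropic multipliers vanish identically**: if `Λ_m < π/β` (in particular for every `m > n_β`,
`klth_klScale_lt_pi_div`) then `klIsoFamily … m ω ≡ 0`, because `|k₀| ≥ π/β > Λ_m` (`pi_div_le_abs_matsubaraFreq`). [folklore] -/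
theorem klIsoFamily_eq_zero_of_klScale_lt {L M : ℕ} [NeZero L] {e₀ β : ℝ} (he : 0 < e₀) (hβ : 0 < β) (μ : ℝ) (K : TrigPolyC4v)
    {m : ℕ} (hm : klScale e₀ m < π / β) (ω : Fin (sectorCount (2 * m))) (k : FreqMomentum L M) :
    klIsoFamily L M β μ K e₀ m ω k = 0 := by
  unfold klIsoFamily klIsoMultiplier
  have h1 : π / β ≤ |matsubaraFreq β M k.1| := pi_div_le_abs_matsubaraFreq hβ k.1
  have h2 : |matsubaraFreq β M k.1| ≤ Real.sqrt (matsubaraFreq β M k.1 ^ 2 + nambuXiCT L μ K k.2 ^ 2) := by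
    rw [← Real.sqrt_sq_eq_abs]
    exact Real.sqrt_le_sqrt (by nlinarith [sq_nonneg (nambuXiCT L μ K k.2)])
  have h0 : gnScaleCutoff 4 e₀ (-(m : ℤ)) (Real.sqrt (matsubaraFreq β M k.1 ^ 2 + nambuXiCT L μ K k.2 ^ 2)) = 0 := by
    refine gnScaleCutoff_eq_zero (by norm_num) he ?_
    rw [zpow_neg, zpow_natCast]
    change klScale e₀ m ≤ _
    linarith
  rw [h0, zero_mul, Complex.ofReal_zero]

end Summit.HubbardSuperconductivity.HubbardSuperconductivity.Theorems.TorusFourierL2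

end
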